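import Mathlib
import HarnessLib
import HarnessLib.Audit
import Summits.NavierStokesRegularity.Statement
import Summits.NavierStokesRegularity.NavierStokesRegularity.Theses.RootDecompIntermittency
import Summits.NavierStokesRegularity.NavierStokesRegularity.Theses.RootDecompTerminalEnergy
import Summits.NavierStokesRegularity.NavierStokesRegularity.Theorems.RootDecompIntermittencyNoActivelyThinBlowup
import HarnessLib.Audit.Status.Attr

/-!
Route: RootDecompFrontierFloor

# Route RootDecompFrontierFloor — Frontier floor recut — Clay (A) iff no filament-frontier blow-up,
no wild-blob blow-up, and N1's tame cells

Root decomposition cell decomp-ns, node N33 (lens-1 g4 «TAME-FRONTIER RECUT», critic CLEARED row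
47), a CHILD of N8
`RootDecompIntermittency` at its declared residual X₂ `NoThickFrontierBlowup` (stmt 27234: no
blow-up whose top saturated
Littlewood–Paley shell is NOT eventually 1-thin), recut against N1 `RootDecompTerminalEnergy`. It
suffices to show
X = K ∧ X₁ ∧ W₂ where K = `TameConeRest` is N1's two TAME cells BY NAME (NoTameTypeII stmt 24828 ∧
NoTypeIBlowup stmt 1217),
X₁ = `NoThinFrontierBlowup` is N8's crux stmt 27233 VERBATIM (ATTACKED: no filament-frontier
blow-up), and W₂ =
`NoWildBlobBlowup` is the NEW, strictly smaller lineage residual (DECLARED RESIDUAL: a blob-frontier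
blow-up that is WILD at T,
`‖u(t) − u(T)‖₂ ↛ 0`, does not occur). The recut is EXACT relative to K (`X₂ ↔ W₂` given E₂ ∧ P1,
writer Sketch
`noThickFrontierBlowup_iff_recut`; four-cell exactness `root_iff_pieces`), and `closes` is N8's born
`closes` with
X₂ := (excluded middle on tameness: tame ∧ Type I → P1, tame ∧ Type II → E₂, wild → W₂).
Lean:
`Summit.NavierStokesRegularity.NavierStokesRegularity.Theses.RootDecompIntermittency.NoThinFrontierBlowup
∧
Summit.NavierStokesRegularity.NavierStokesRegularity.Theses.RootDecompIntermittency.NoThickFrontierBlowup`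

## Assembly
Pure logic through the parent: N8's born deciding theorem `RootDecompIntermittency.closes (h₁ :
NoThinFrontierBlowup)
(h₂ : NoThickFrontierBlowup) : NavierStokesRegularity` is called BY NAME with h₁ := X₁ and h₂ := the
recut: given a thick-frontier
classical solution that does not extend, it is maximal; if tame, E₂ (K.1) makes it Type I and P1
(K.2) extends it; if wild, W₂ extends it.

Rationale: WHY THIS LINE. N8 cut the root by the GEOMETRY of the dissipation frontier (Cheskidov–Shvydkoy
intermittency at the top saturated shell,
arXiv:1102.1944, arXiv:2203.11060) and left the thick-frontier cell X₂ as residual; N1 cut it by the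
terminal ENERGY MEASURE
(Leslie–Shvydkoy, arXiv:1705.04420: atom / dust / tame). The lens proves (0 sorry,
HOME/decomp-ns-lens-1/FrontierFloorRecut.lean
§9b) the bridge Φ «a TAME first blow-up has a BLOB frontier» from the FRONTIER FLOOR — a saturated
1-thin shell carries an
absolute L²-quantum c₀ν/C at frequency 2^Q → ∞, which L²-convergence u(t) → u(T) forbids
(Cheskidov–Shvydkoy 2010 Lemma 3.2,
landed as `FluidComputer.TerminalWindowFloor.exists_saturated_after'`, + Littlewood–Paley block
continuity). Consequences:
the two partitions are NOT transverse in the tame cells (filament ∧ tame = ∅), every Type-I blow-up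
has a blob frontier
(tree `NoTerminalJolt.tendsto_eLpNorm_sub_of_isTypeIBlowup`), X₂ loses its whole tame part to N1's
EXISTING items, and the
only new cell is W₂ = blob ∧ wild — Type-I-free by kernel, NSI-free (catalogued NSI blow-ups are
tame) and Tao-free under the
census placement (the averaged cascade is tame at T*, census v38 H37): with A (N32), F, G₂ it is one
of the census's four
barrier-free residual cells, all of Leslie–Shvydkoy Question 1.1 type. Imported from harmonic
analysis: Littlewood–Paley
saturation/Bernstein bookkeeping; from N1: the energy-measure cells by name.

RANKED CRUXES. #2 NoThinFrontierBlowup (crux) — (piece X₁ = N8 item 27233 VERBATIM, ATTACKED) a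
classical solution on ℝ³ × [0,T), Leray–Hopf from its rapidly decaying datum, whose frontier (top
saturated) Littlewood–Paley shell is 1-thin with one constant at all late times, for every threshold
c₀ ∈ (0,1], extends smoothly past T. Lines: (1) N8's registered skeleton CS14Criterion →
FrontierL2Apriori → ThickBelowThinDeficit; (2) THIS node's Φ-line, registered at birth: Φ (PROVABLE
NOW) ∧ NoWildBlowup (= N1's P2 ∧ J1, = N32's P2 ∧ A ∧ B) ⟹ X₁ (writer Sketch
`noThinFrontierBlowup_of_phi`). [difficulty: L] (why it might fail: A 1-thin frontier yields only Λ
∈ L²(t₀,T); saturated blob shells BELOW it need the critical B^(-1)_(∞,∞) low-mode bound nothing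
supplies — a blow-up fed by intensifying blobs under a tube-like frontier (an energy-carrying 1-dust
clustering to an atom) is excluded by nothing known.) [arXiv:1102.1944, arXiv:2203.11060,
arXiv:1507.06611, arXiv:1705.04420]
#3 NoWildBlobBlowup (crux) — (piece W₂, NEW lineage residual, DECLARED RESIDUAL, leaf IDEA-NEEDED) a
classical solution on ℝ³ × [0,T), Leray–Hopf from its rapidly decaying datum, whose frontier shell
is NOT eventually 1-thin (blob-like concentration recurs up to T) AND which is NOT tame at T (‖u(t)
− u(T)‖₂ ↛ 0: a terminal energy defect, atom or dust), extends smoothly past T. Strictly WEAKER than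
X₂ (kernel; dropped class = tame blob blow-ups ∋ every Type-I blow-up), than NoWildBlowup (dropped
class = wild filament blow-ups = X₁'s cell) and than S. [difficulty: XL] (why it might fail: An
energy-carrying point collapse at sup-rate β ≥ 3/5 with a bump (D = 0) frontier, or a blob cascade
depositing diffuse dust on Σ_T — Leslie–Shvydkoy Question 1.1; never constructed even for the NS
inequality, excluded by nothing in print.) [arXiv:1705.04420, arXiv:1402.0290, arXiv:1809.02109,
arXiv:1709.00602]
#9 TameConeRest (support) — N1's two TAME cells BY NAME: no tame Type-II first blow-up (E₂, stmt
24828) ∧ no Type-I blow-up for Clay data (P1, stmt 1217); staffed on the parent routes, bundled here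
so that this child's deciding theorem is N8's `closes` verbatim with X₂ recut. [difficulty: XL]
[arXiv:1705.04420, KNSS2009]
#9 TameHasBlobFrontier (support) — (Φ, PROVABLE NOW — lens theorem `tameHasBlobFrontier_holds`, 0
sorry, ≈ 250 lines to port; stub `stub_tameHasBlobFrontier` of X₁'s registered Φ-line) for a maximal
smooth solution on [0,T), Leray–Hopf from a rapidly decaying datum, if ‖u(t) − u(T)‖₂ → 0 as t ↑ T
then the frontier shell is NOT eventually 1-thin: a tame first blow-up has a blob frontier
(contrapositive: a filament-or-fuller frontier forces a terminal energy defect). [difficulty: M]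
[arXiv:1102.1944, arXiv:1705.04420, CheskidovShvydkoy2010]
#9 NoSuperFilamentFrontierBlowup (support) — (RUNG, PROVABLE NOW — lens theorem
`noSuperFilamentFrontierBlowup_holds`, 0 sorry; the rungs D > 1 of N8's ladder, a CONSEQUENCE of X₁
by antitonicity, filed ASIDE as the banked first rung) for every D > 1, a classical Leray–Hopf
solution on [0,T) from a rapidly decaying datum whose frontier shell is D-thin (‖Δ̇ⱼu‖_∞ ≤
C·2^((3−D)j/2)‖Δ̇ⱼu‖₂ at the frontier level, all late times, every threshold) extends past T —
Leray's energy bound caps saturated D-thin levels. [difficulty: M] [arXiv:1102.1944,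
CheskidovShvydkoy2010]

TWO-LAYER PLAN. X₁ ⇐ Φ ∧ NoWildBlowup (registered Φ-line; Φ provable now, NoWildBlowup = N1's P2 ∧
J1 = N32's P2 ∧ A ∧ B — so closing N1's
wild items closes X₁; a Theorems helper `NoEnergyAtom → AtomFreeBlowupIsTame → NoThinFrontierBlowup`
is landable today by
porting lens §§1–2, 4b, 8–9b, ≈ 500 lines) next to N8's own line CS14Criterion → FrontierL2Apriori →
ThickBelowThinDeficit.
W₂ is deliberately left whole (declared residual; instrumentable by N1's exponent test and census
T2/T-Tao).

KILL CRITERIA. A refutation of X₁ (a filament-frontier blow-up from a Schwartz datum) or of W₂ (a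
wild blob blow-up) is a finite-time
blow-up, i.e. Clay (C): it closes this route AND the summit negatively. A proof of X₂ on N8, or of
P2 ∧ J1 on N1 (which gives
X₁ ∧ W₂ by the Sketch's `noWildBlobBlowup_of_N1` and the Φ-line), moots the node. If the census test
T2/T-Tao finds the averaged
cascade WILD at T*, W₂ becomes Tao-loaded and its leaf tag changes from IDEA-NEEDED to BARRIER
(TaoAveragedBlowup inside) —
recorded, not a kill.

NOT DECOMPOSED YET. W₂ (residual) is not split: its sub-grading by frontier dimension D ∈ [0,1) has
no provable rung (criterion (5−D)/2 > a-priori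
1+D everywhere, lens β-collapse census), and its split by defect geometry is exactly N1's P2/J1 and
N32's A/B, already items.
X₁'s second layer lives in the registered skeletons, not in items (two-layer rule).

CHEAPEST FALSIFIER. Kernel probes (ran, this session): BC2 `X₁ → S`, `W₂ → S`, `K → S` must FAIL;
BC7 tautology probes must be CLEAN; `exact?` dedup
must FAIL — see Novelty/birth certificate. Mathematical: the frontier floor at D = 1 is scale-free,
so the cheapest kill of the
LINE (not of X₁) is a tame solution with a 1-thin saturated frontier at levels Q → ∞ — impossible by
Φ (lens theorem, 0 sorry):
no kill. For W₂: compute e_∞ (terminal energy jump) of Tao's averaged cascade band (arXiv:1402.0290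
§6) — census test T2;
wild ⇒ W₂ Tao-loaded (tag change), tame ⇒ W₂ stays barrier-free. No kit (kit_allowed = false).

NUMBERS. Frontier floor: a c₀-saturated 1-thin shell has ‖Δ̇_Q u‖₂ ≥ c₀ν/C (lens `frontier_floor`).
Rungs: D > 1 THEOREM (floor grows
like 2^((D−1)Q/2) against ‖u(t)‖₂ ≤ ‖u₀‖₂); D = 1 = X₁ OPEN; print ceiling before the lens: D > 3/2
time-averaged
(Cheskidov–Shvydkoy 2014 Thm 5.1). LS18: Type-I ⇒ tame (Thm 1.2, tree theorem); atom threshold rate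
(T−t)^(-3/5).
Cells: {filament frontier} ⊔ {blob ∧ wild} ⊔ {tame ∧ Type II} ⊔ {Type I} — exact cover (Sketch
`root_iff_pieces`).

DEFINITION REQUESTS. None: the pieces inline N8's predicates (IsSaturatedLevel, blockFn — tree
Literature decls) exactly as stmt 27233/27234 do;
tameness is the N1 sub-expression verbatim.

Novelty: Searches (lens 2026-08-30, re-verified by the writer 2026-08-31): lit search --hybrid "dissipation
wavenumber energy equality blow-up Littlewood-Paley" → turbulence monographs only [corpus:frisch1995
p.130 (β-model: intermittency as co-dimension 3−D), corpus:foias2001 p.236]; lit vsearch "energy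
equality fails when energy escapes to high Littlewood-Paley shells; intermittency dimension;
dissipation wavenumber" → [corpus:frisch1995 p.130, corpus:bohr1998 p.83], no paper hit; lit read
arxiv:1705.04420 [corpus:paper:arxiv-1705.04420 p.4 Question 1.1, p.5 Thm 1.2, p.14]; lit galaxy
search "dissipation wavenumber|concentration dimension|energy measure at the blow" --star all → no
relevant hit; lit galaxy search "Cheskidov|Shvydkoy" --star pdf → [galaxy:pdf:1396630140
Cheskidov–Zeng–Zhang 2024 arXiv:2407.17463 (continuous-energy non-unique weak solutions; irrelevant
to first blow-up of classical ones)], [galaxy:pdf:3099985620 Berselli–Kaltenbach–Růžička 2024]; lean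
search 'NoThinFrontierBlowup' / 'IsSaturatedLevel' / 'tendsto_eLpNorm_sub_of_isTypeIBlowup' → N8's
items and the LS18 tree theorem; ledger negatives --problem NavierStokesRegularity: nothing on
frontier thinness ∧ terminal defect.
Nearest prior art found: Cheskidov–Shvydkoy 2014 (arXiv:1102.1944) Thm 3.1/§5 and arXiv:2203.11060 —
regularity for intermittency dimension D > 3/2 at the dissipation range (time-averaged);
Leslie–Shvydkoy 2018 (arXiv:1705.04420) Thm 1.2 / Q 1.1 — energy measure at blow-up, Type I ⇒ tame;
in th  [refs: 1705.04420, 2407.17463, 1102.1944, 2203.11060, arxiv:1705.04420, paper:arxiv-1705.04420]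

Barriers (technique_class: LP-dissipation-frontier, intermittency, energy-measure): - technique_class: LP-dissipation-frontier, intermittency, energy-measure
- Literature.Barriers.NavierStokesRegularity.EnergySupercriticality: the PROVED parts (Φ, rungs D >
1) are necessary-geometry statements inside the energy class and claim no regularity — no conflict;
X₁'s provable core (D > 1, actively-thin S₁) is outside, its open core (blobs below a thin frontier)
inside, exactly as placed on N8; W₂ is INSIDE for any abstract energy-class argument — it does not
evade the barrier; the bet is the exact equation's local energy structure at the collapse point
(N1's layer-2 line for P2), which is why W₂ is the DECLARED RESIDUAL.
- Literature.Barriers.NavierStokesRegularity.TaoAveragedBlowup: X₁ is vacuous on the averaged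
cascade (D = 0 packets, N8's booking [corpus:arxiv-1402.0290 p.14, p.21]); W₂ is Tao-free iff the
cascade is tame at T* (census placement v38 H37: tame ⇒ loads E₂/U, not W₂; test T2 decisive); Φ and
the rungs are averaging-blind statements about ANY system obeying CS10 Lemma 3.2 + the energy
inequality — allowed, they exclude nothing.
- Literature.Barriers.NavierStokesRegularity.AveragedTypeIBlowup: bites neither X₁ nor W₂ (both
cells are Type-I-free by kernel: LS18 Thm 1.2 + Φ); it sits on P1 inside K, staffed on the parents.
- Literature.Barriers.NavierStokesRegularity.NSITypeIIBlowup: the catalogued NSI Type-II witnesses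
are defect-free (tame) [arXiv:1809.02109 p.8; arXiv:1709.00602 §5.5, as booked on N1] ⇒ OUTSIDE W₂
and, being D < 1 cascades (N8), out

sub-problem: NavierStokesRegularity · status: draft · opened planner-decomp-ns-writer-1-g29-0 2026-08-31T11:06:51Z · rev 1 · ledger route-NavierStokesRegularity-RootDecompFrontierFloor
GENERATED by the gate from the ledger (D-0016/17). Provers cite these decls: `theorem foo : Summit.NavierStokesRegularity.NavierStokesRegularity.Theses.RootDecompFrontierFloor.<Decl> := …` in Summits/NavierStokesRegularity/NavierStokesRegularity/Theorems/<Name>.lean.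
-/

namespace Summit.NavierStokesRegularity.NavierStokesRegularity.Theses.RootDecompFrontierFloor

open scoped BigOperators Topology Manifold Classical MeasureTheory ProbabilityTheory Matrix InnerProductSpace ComplexConjugate ContinuousMap
open Filter Set Function TopologicalSpace MeasureTheory

attribute [summit_statement] _root_.NavierStokesRegularity

open Literature.NS

/-- item stmt-NavierStokesRegularity-27233 · crux · leaf ATTACKABLE · rank 2 · open · by planner
why it might fail: A 1-thin frontier yields only Λ ∈ L²(t₀,T); saturated blob shells BELOW it need the critical B^(-1)_(∞,∞) low-mode bound nothing supplies — a blow-up fed by intensifying blobs under a tube-like frontier (an energy-carrying 1-dust clustering to an atom) is excluded by nothing known.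
sources: arXiv:1102.1944, arXiv:2203.11060, arXiv:1507.06611, arXiv:1705.04420
[crux] NO THIN-FRONTIER BLOW-UP (X₁ = NoThinFrontierBlowupAt 1, predicates INLINED: `IsFrontierLevel
c₀ ν v j` := saturated ∧ no saturated shell above; `IsThinLevel 1 C v j` := ‖Δ̇ⱼv‖_∞ ≤
C·2^{(3−1)j/2}‖Δ̇ⱼv‖₂ over tree `blockFn`, `IsSaturatedLevel`) [tag WEAKER(evidence: S ⟹ X₁ kernel
`noThinFrontierBlowup_of_root`; X₁ vacuous on every thick-frontier blow-up — separating class =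
thin-frontier blow-ups, excluded by NO theorem in print; sibling evidence the cell is not empty
nearby: 3D Euler with boundary blows up on a fixed-radius RING (Chen–Hou), a 1-thin frontier) ·
ATTACKABLE-PARTIAL (critic row 35; typed line kernel-composed: CS14Criterion (L, port of CS14 Thm
3.1) + FrontierL2Apriori (M, printed computation) + ThickBelowThinDeficit (THE OPEN LEMMA) ⟹ X₁ =
the BC3 skeleton; first rung S₁ PROVABLE NOW) · Tao-COMPATIBLE (averaged blow-up has a thick
frontier; census test T-thin-2 requested)]. A classical solution on ℝ³ × [0,T), Leray–Hopf from its
rapidly decaying datum, whose frontier Littlewood–Paley shell is 1-thin with one constant at all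
late times, for every threshold c₀ ∈ (0,1], extends smoothly past T. [difficulty: L] -/
@[route_item "route-NavierStokesRegularity-RootDecompFrontierFloor", crux (bottleneck := work) (source := "ledger D-0171 leaf tag ATTACKABLE on stmt-NavierStokesRegularity-27233, 2026-09-01")]
def NoThinFrontierBlowup : Prop :=
  ∀ (ν T : ℝ), 0 < ν → 0 < T → ∀ (u : ℝ → EuclideanSpace ℝ (Fin 3) → EuclideanSpace ℝ (Fin 3)) (p : ℝ → EuclideanSpace ℝ (Fin 3) → ℝ), Literature.Analysis.FluidPDE.IsClassicalNSSolutionOn (Set.Ico 0 T) ν 0 u p → Literature.Analysis.FluidPDE.IsLerayHopfOn T ν 0 (u 0) u → Literature.Analysis.FluidPDE.HasRapidSpatialDecay (u 0) → (∀ c₀ : ℝ, 0 < c₀ → c₀ ≤ 1 → ∃ C t₀ : ℝ, t₀ < T ∧ ∀ t ∈ Set.Ioo t₀ T, ∀ j : ℕ, (Literature.Analysis.FluidPDE.IsSaturatedLevel c₀ ν (u t) j ∧ ∀ k : ℕ, j < k → ¬ Literature.Analysis.FluidPDE.IsSaturatedLevel c₀ ν (u t) k) → MeasureTheory.eLpNorm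 (Literature.Analysis.FunctionSpaces.blockFn (j : ℤ) (u t)) ⊤ MeasureTheory.volume ≤ ENNReal.ofReal (C * (2 : ℝ) ^ ((3 - (1 : ℝ)) / 2 * (j : ℝ))) * MeasureTheory.eLpNorm (Literature.Analysis.FunctionSpaces.blockFn (j : ℤ) (u t)) 2 MeasureTheory.volume) → Literature.Analysis.FluidPDE.HasSmoothExtensionPast ν 0 u T

/-- item stmt-NavierStokesRegularity-27237 · crux · RESIDUAL (gen 0; summit-strength until shown otherwise, D-0170) · leaf IDEA-NEEDED · rank 3 · open · by planner
why it might fail: An energy-carrying point collapse at sup-rate β ≥ 3/5 with a bump (D = 0) frontier, or a blob cascade depositing diffuse dust on Σ_T — Leslie–Shvydkoy Question 1.1; never constructed even for the NS inequality, excluded by nothing in print.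
sources: arXiv:1705.04420, arXiv:1402.0290, arXiv:1809.02109, arXiv:1709.00602
[crux] (piece W₂, NEW lineage residual, DECLARED RESIDUAL, leaf IDEA-NEEDED) a classical solution on
ℝ³ × [0,T), Leray–Hopf from its rapidly decaying datum, whose frontier shell is NOT eventually
1-thin (blob-like concentration recurs up to T) AND which is NOT tame at T (‖u(t) − u(T)‖₂ ↛ 0: a
terminal energy defect, atom or dust), extends smoothly past T. Strictly WEAKER than X₂ (kernel;
dropped class = tame blob blow-ups ∋ every Type-I blow-up), than NoWildBlowup (dropped class = wild
filament blow-ups = X₁'s cell) and than S. [difficulty: XL] -/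
@[route_item "route-NavierStokesRegularity-RootDecompFrontierFloor", crux (bottleneck := idea) (source := "ledger wanted_by.residual on stmt-NavierStokesRegularity-27237, 2026-09-01")]
def NoWildBlobBlowup : Prop :=
  ∀ (ν T : ℝ), 0 < ν → 0 < T → ∀ (u : ℝ → EuclideanSpace ℝ (Fin 3) → EuclideanSpace ℝ (Fin 3)) (p : ℝ → EuclideanSpace ℝ (Fin 3) → ℝ), Literature.Analysis.FluidPDE.IsClassicalNSSolutionOn (Set.Ico 0 T) ν 0 u p → Literature.Analysis.FluidPDE.IsLerayHopfOn T ν 0 (u 0) u → Literature.Analysis.FluidPDE.HasRapidSpatialDecay (u 0) → ¬ (∀ c₀ : ℝ, 0 < c₀ → c₀ ≤ 1 → ∃ C t₀ : ℝ, t₀ < T ∧ ∀ t ∈ Set.Ioo t₀ T, ∀ j : ℕ, (Literature.Analysis.FluidPDE.IsSaturatedLevel c₀ ν (u t) j ∧ ∀ k : ℕ, j < k → ¬ Literature.Analysis.FluidPDE.IsSaturatedLevel c₀ ν (u t) k) → MeasureTheory.eLpNorm (Literature.Analysis.FunctionSpaces.blockFn (j : ℤ) (u t)) ⊤ MeasureTheory.volume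 ≤ ENNReal.ofReal (C * (2 : ℝ) ^ ((3 - (1 : ℝ)) / 2 * (j : ℝ))) * MeasureTheory.eLpNorm (Literature.Analysis.FunctionSpaces.blockFn (j : ℤ) (u t)) 2 MeasureTheory.volume) → ¬ Filter.Tendsto (fun t => MeasureTheory.eLpNorm (u t - u T) 2 MeasureTheory.volume) (nhdsWithin T (Set.Iio T)) (nhds 0) → Literature.Analysis.FluidPDE.HasSmoothExtensionPast ν 0 u T

/-- item stmt-NavierStokesRegularity-27238 · support · rank 9 · open · by planner
sources: arXiv:1705.04420, KNSS2009
[support] N1's two TAME cells BY NAME: no tame Type-II first blow-up (E₂, stmt 24828) ∧ no Type-I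
blow-up for Clay data (P1, stmt 1217); staffed on the parent routes, bundled here so that this
child's deciding theorem is N8's `closes` verbatim with X₂ recut. [difficulty: XL] -/
@[route_item "route-NavierStokesRegularity-RootDecompFrontierFloor", crux]
def TameConeRest : Prop :=
  Summit.NavierStokesRegularity.NavierStokesRegularity.Theses.RootDecompTerminalEnergy.NoTameTypeII ∧ Summit.NavierStokesRegularity.NavierStokesRegularity.Theses.RootDecompTerminalEnergy.NoTypeIBlowup

/-- item stmt-NavierStokesRegularity-27239 · support · rank 9 · open · by planner
sources: arXiv:1102.1944, arXiv:1705.04420, CheskidovShvydkoy2010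
[support] (Φ, PROVABLE NOW — lens theorem `tameHasBlobFrontier_holds`, 0 sorry, ≈ 250 lines to port;
stub `stub_tameHasBlobFrontier` of X₁'s registered Φ-line) for a maximal smooth solution on [0,T),
Leray–Hopf from a rapidly decaying datum, if ‖u(t) − u(T)‖₂ → 0 as t ↑ T then the frontier shell is
NOT eventually 1-thin: a tame first blow-up has a blob frontier (contrapositive: a
filament-or-fuller frontier forces a terminal energy defect). [difficulty: M] -/
@[route_item "route-NavierStokesRegularity-RootDecompFrontierFloor"]
def TameHasBlobFrontier : Prop :=
  ∀ (ν T : ℝ), 0 < ν → 0 < T → ∀ (u : ℝ → EuclideanSpace ℝ (Fin 3) → EuclideanSpace ℝ (Fin 3)) (p : ℝ → EuclideanSpace ℝ (Fin 3) → ℝ), Literature.Analysis.FluidPDE.IsMaximalSmoothSolution ν 0 u p T → Literature.Analysis.FluidPDE.IsLerayHopfOn T ν 0 (u 0) u → Literature.Analysis.FluidPDE.HasRapidSpatialDecay (u 0) → Filter.Tendsto (fun t => MeasureTheory.eLpNorm (u t - u T) 2 MeasureTheory.volume) (nhdsWithin T (Set.Iio T)) (nhds 0) → ¬ (∀ c₀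 : ℝ, 0 < c₀ → c₀ ≤ 1 → ∃ C t₀ : ℝ, t₀ < T ∧ ∀ t ∈ Set.Ioo t₀ T, ∀ j : ℕ, (Literature.Analysis.FluidPDE.IsSaturatedLevel c₀ ν (u t) j ∧ ∀ k : ℕ, j < k → ¬ Literature.Analysis.FluidPDE.IsSaturatedLevel c₀ ν (u t) k) → MeasureTheory.eLpNorm (Literature.Analysis.FunctionSpaces.blockFn (j : ℤ) (u t)) ⊤ MeasureTheory.volume ≤ ENNReal.ofReal (C * (2 : ℝ) ^ ((3 - (1 : ℝ)) / 2 * (j : ℝ))) * MeasureTheory.eLpNorm (Literature.Analysis.FunctionSpaces.blockFn (j : ℤ) (u t)) 2 MeasureTheory.volume)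

/-- item stmt-NavierStokesRegularity-27240 · aside · rank 9 · open · by planner
sources: arXiv:1102.1944, CheskidovShvydkoy2010
[support] (RUNG, PROVABLE NOW — lens theorem `noSuperFilamentFrontierBlowup_holds`, 0 sorry; the
rungs D > 1 of N8's ladder, a CONSEQUENCE of X₁ by antitonicity, filed ASIDE as the banked first
rung) for every D > 1, a classical Leray–Hopf solution on [0,T) from a rapidly decaying datum whose
frontier shell is D-thin (‖Δ̇ⱼu‖_∞ ≤ C·2^((3−D)j/2)‖Δ̇ⱼu‖₂ at the frontier level, all late times,
every threshold) extends past T — Leray's energy bound caps saturated D-thin levels. [difficulty: M] -/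
@[route_item "route-NavierStokesRegularity-RootDecompFrontierFloor"]
def NoSuperFilamentFrontierBlowup : Prop :=
  ∀ D : ℝ, 1 < D → ∀ (ν T : ℝ), 0 < ν → 0 < T → ∀ (u : ℝ → EuclideanSpace ℝ (Fin 3) → EuclideanSpace ℝ (Fin 3)) (p : ℝ → EuclideanSpace ℝ (Fin 3) → ℝ), Literature.Analysis.FluidPDE.IsClassicalNSSolutionOn (Set.Ico 0 T) ν 0 u p → Literature.Analysis.FluidPDE.IsLerayHopfOn T ν 0 (u 0) u → Literature.Analysis.FluidPDE.HasRapidSpatialDecay (u 0) → (∀ c₀ : ℝ, 0 < c₀ → c₀ ≤ 1 → ∃ C t₀ : ℝ, t₀ < T ∧ ∀ t ∈ Set.Ioo t₀ T, ∀ j : ℕ, (Literature.Analysis.FluidPDE.IsSaturatedLevel c₀ ν (u t) j ∧ ∀ k : ℕ, j < k → ¬ Literature.Analysis.FluidPDE.IsSaturatedLevel c₀ ν (u t) k) → MeasureTheory.eLpNorm (Literature.Analysis.FunctionSpaces.blockFn (j : ℤ) (u t)) ⊤ MeasureTheory.volume ≤ ENNReal.ofReal (C * (2 : ℝ) ^ ((3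 - D) / 2 * (j : ℝ))) * MeasureTheory.eLpNorm (Literature.Analysis.FunctionSpaces.blockFn (j : ℤ) (u t)) 2 MeasureTheory.volume) → Literature.Analysis.FluidPDE.HasSmoothExtensionPast ν 0 u T

/-- item stmt-NavierStokesRegularity-27241 · assembly · rank 1 · open · by planner
sources: arXiv:1102.1944, arXiv:1705.04420
[assembly] N1's tame cells, no filament-frontier blow-up and no wild-blob blow-up imply Clay (A). -/
@[route_item "route-NavierStokesRegularity-RootDecompFrontierFloor"]
def Assembly : Prop :=
  TameConeRest → NoThinFrontierBlowup → NoWildBlobBlowup → NavierStokesRegularity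

/-! D-0027 §2.1 — DECIDING THEOREM (planner-authored via `route open/edit --closes-file`; by planner-decomp-ns-writer-1-g29-0 2026-08-31T11:08:12Z):
its hypotheses are this route's items and its conclusion the sub-problem Statement (glue_lint), and it elaborates with this file. -/

@[closes "route-NavierStokesRegularity-RootDecompFrontierFloor"] theorem closes (hK : TameConeRest) (h₁ : NoThinFrontierBlowup) (h₂ : NoWildBlobBlowup) : NavierStokesRegularity :=
  Summit.NavierStokesRegularity.NavierStokesRegularity.Theses.RootDecompIntermittency.closes h₁
    (fun ν T hν hT u p hcl hLH hdec hthick => Classical.byContradiction fun hext =>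
      (Classical.em (Filter.Tendsto (fun t => MeasureTheory.eLpNorm (u t - u T) 2 MeasureTheory.volume)
          (nhdsWithin T (Set.Iio T)) (nhds 0))).elim
        (fun htame => hext (hK.2 ν T hν hT u p hcl hLH hdec (hK.1 ν T hν hT u p ⟨hcl, hext⟩ hLH hdec htame)))
        (fun hwild => hext (h₂ ν T hν hT u p hcl hLH hdec hthick hwild)))

end Summit.NavierStokesRegularity.NavierStokesRegularity.Theses.RootDecompFrontierFloor
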